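import Summits.QuantumAdvantage.QuantumAdvantage.Theorems.LinnikCubicClassGroupsDegreeOnePrimesEscapeDedekindRelation
import Literature.NumberTheory.NumberFields.ArithmeticEquivalenceProofs
import Literature.NumberTheory.LFunctions.PrimeIdealCountDegreeOne
import Mathlib.NumberTheory.NumberField.Discriminant.Different
import Mathlib.NumberTheory.RamificationInertia.Galois
import HarnessLib

/-!
# Splitting types in an `S₃`-sextic, prime by prime: the Frobenius dictionary without Frobenius

Topic `Summits/QuantumAdvantage/QuantumAdvantage/Theorems`, cell B2b-1 (linnik-cubic), PART A (gen 7);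
helper toward the crux `DegreeOnePrimesEscape` (stmt-QuantumAdvantage-11543) of route
`LinnikCubicClassGroups`.  HONEST FRAMING: the value of this file is a THEOREM (kernel-checked
arithmetic bookkeeping) — NOT summit progress.

For a number field `E` and a prime `p` write `a_E(p)` for the number of prime ideals of `E` above `p` of
residue degree one (`= (splittingType E p).count 1 = idealNormCount E p`, the number of ideals of norm
`p`).  Let `N/ℚ` be Galois of degree `6` with non-abelian group (`≅ S₃`), `K ⊂ N` a cubic and `k ⊂ N`
a quadratic subfield.  At EVERY prime `p` the splitting types satisfy
`T_N(p) + {1,1} = T_k(p) + T_K(p) + T_K(p)` (`splittingType_sextic_add_two_eq`), whence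
`a_N(p) + 2 = a_k(p) + 2 a_K(p)`; and at a prime `p ∤ d_N` one has `a_N(p) ∈ {0, 6}` (Galois: all
residue degrees above `p` coincide and sum to `6`).  Consequently, at `p ∤ d_N` the triple
`(a_k(p), a_K(p), a_N(p))` is one of `(2,3,6)` (Frobenius `= 1`: `p` splits completely), `(0,1,0)`
(transpositions: `p = 𝔭₁𝔭₂` in `K`, inert in `k`), `(2,0,0)` (3-cycles: `p` INERT in `K`, split in
`k`) — the Frobenius dictionary of the `S₃`-extension, obtained here by counting alone:

* `count_one_splittingType_eq_zero_or_eq_finrank` — `a_N(p) ∈ {0, [N:ℚ]}` for `N/ℚ` Galois, `p ∤ d_N`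
  (with the tree's `sum_splittingType_eq_finrank`: at `p ∤ d_K` the residue degrees sum to `[K:ℚ]`);
* `sextic_three_mul_inert_add` — `3·𝟙[a_K(p) = 0] + a_K(p) = 1 + a_k(p)` at `p ∤ d_N`;
* `sextic_two_mul_partial_add` — `2·𝟙[a_K(p) = 1] + a_k(p) = 2` at `p ∤ d_N`;
* `sextic_six_mul_inert_add` — `6·𝟙[a_K(p) = 0] + a_N(p) = 3 a_k(p)` at `p ∤ d_N`;
* `isPrime_span_of_count_one_eq_zero` — for a cubic field, `p ∤ d_K` and `a_K(p) = 0` imply that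
  `p𝓞_K` is a prime ideal (`p` is inert in `K`).

References: R. Perlis, J. Number Theory 9 (1977) (splitting types) [Perlis1977]; D. A. Marcus,
*Number Fields*, Ch. 4 [Marcus2018].
-/

noncomputable section

open scoped NumberField nonZeroDivisors
open Ideal NumberField UniqueFactorizationMonoid PowerSeries
open Literature.NumberTheory.NumberFields Literature.NumberTheory.LFunctions

namespace Summit.QuantumAdvantage.QuantumAdvantage.Theorems.DegreeOnePrimesEscape

/-! ### `a_E(p) = (splittingType E p).count 1 = idealNormCount E p`, and the degree sum -/

section General

variable {K : Type*} [Field K] [NumberField K]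

/-- The constant coefficient of the generating series of a splitting type is `1`. -/
private theorem coeff_zero_typeSeries (T : Multiset ℕ) : coeff 0 (typeSeries T) = 1 := by
  induction T using Multiset.induction_on with
  | empty => simp
  | cons a T ih => rw [typeSeries_cons, coeff_zero_eq_constantCoeff, map_mul,
      ← coeff_zero_eq_constantCoeff_apply, ← coeff_zero_eq_constantCoeff_apply,
      coeff_zero_geomSeries, ih, one_mul]

/-- The linear coefficient of the generating series of a splitting type is the number of `1`'s. -/
private theorem coeff_one_typeSeries (T : Multiset ℕ) :
    coeff 1 (typeSeries T) = (T.count 1 : ℤ) := by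
  classical
  induction T using Multiset.induction_on with
  | empty => simp
  | cons a T ih =>
    rw [typeSeries_cons, coeff_mul, Finset.Nat.antidiagonal_succ, Finset.sum_cons,
      Finset.Nat.antidiagonal_zero, Finset.map_singleton, Finset.sum_singleton]
    simp only [Function.Embedding.coe_prodMap, Function.Embedding.coeFn_mk, Prod.map_apply,
      Nat.succ_eq_add_one, zero_add, Function.Embedding.refl_apply]
    rw [coeff_zero_geomSeries, coeff_zero_typeSeries, ih, coeff_geomSeries, Multiset.count_cons,
      one_mul, mul_one]
    by_cases ha : a = 1
    · subst ha; simp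
    · have hna : ¬ a ∣ 1 := fun h => ha (Nat.dvd_one.mp h)
      rw [if_neg hna, if_neg (Ne.symm ha)]; push_cast; ring

/-- **`a_K(p)`: the number of ideals of norm `p` is the number of `1`'s in the splitting type of
`p`** (both count the degree-one primes above `p`). -/
theorem idealNormCount_eq_count_one_splittingType {p : ℕ} (hp : p.Prime) :
    idealNormCount K p = (splittingType K p).count 1 := by
  have h := idealNormCount_prime_pow_eq_coeff (K := K) hp 1
  rw [pow_one, coeff_one_typeSeries] at h
  exact_mod_cast h

/-- `a_K(p) ≤ [K:ℚ]`. -/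
theorem count_one_splittingType_le_finrank {p : ℕ} (hp : p.Prime) :
    (splittingType K p).count 1 ≤ Module.finrank ℚ K := by
  rw [← idealNormCount_eq_count_one_splittingType hp]
  exact NumberField.idealNormCount_prime_le_finrank K hp

/-- **In a Galois number field, at a prime `p ∤ d_N`, either no prime above `p` has residue degree
one or all `[N:ℚ]` of them do**: `a_N(p) ∈ {0, [N:ℚ]}` (the residue degrees above `p` coincide,
Mathlib `Ideal.inertiaDeg_eq_of_isGaloisGroup`, and sum to `[N:ℚ]`). -/
theorem count_one_splittingType_eq_zero_or_eq_finrank {N : Type*} [Field N] [NumberField N]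
    [IsGalois ℚ N] {p : ℕ} (hp : p.Prime) (hd : ¬ (p : ℤ) ∣ NumberField.discr N) :
    (splittingType N p).count 1 = 0 ∨ (splittingType N p).count 1 = Module.finrank ℚ N := by
  classical
  set nf := normalizedFactors (span {(p : 𝓞 N)}) with hnf
  have hnd : nf.Nodup := nodup_normalizedFactors_of_not_dvd_discr hp hd
  have hT : splittingType N p = nf.map (fun P => P.inertiaDeg ℤ) := by
    rw [splittingType, ← hnf, Multiset.dedup_eq_self.mpr hnd]
  by_cases hne : ∃ P ∈ nf, P.inertiaDeg ℤ = 1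
  · right
    obtain ⟨P₀, hP₀, hf₀⟩ := hne
    obtain ⟨hP₀p, hP₀l⟩ := (mem_normalizedFactors_span_iff hp).1 hP₀
    haveI : IsGaloisGroup (N ≃ₐ[ℚ] N) ℤ (𝓞 N) := IsGaloisGroup.of_isFractionRing _ _ _ ℚ N
    have hall : ∀ P ∈ nf, P.inertiaDeg ℤ = 1 := by
      intro P hP
      obtain ⟨hPp, hPl⟩ := (mem_normalizedFactors_span_iff hp).1 hP
      rw [Ideal.inertiaDeg_eq_of_isGaloisGroup (span {(p : ℤ)}) P P₀ (N ≃ₐ[ℚ] N)]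
      exact hf₀
    have hrep : splittingType N p = Multiset.replicate (Multiset.card nf) 1 := by
      rw [hT, Multiset.eq_replicate]
      refine ⟨Multiset.card_map _ _, fun f hf => ?_⟩
      obtain ⟨P, hP, rfl⟩ := Multiset.mem_map.1 hf
      exact hall P hP
    have hsum := sum_splittingType_eq_finrank hp hd (K := N)
    rw [hrep, Multiset.sum_replicate, smul_eq_mul, mul_one] at hsum
    rw [hrep, Multiset.count_replicate_self, hsum]
  · left
    rw [Multiset.count_eq_zero, hT]
    intro h1
    obtain ⟨P, hP, hf⟩ := Multiset.mem_map.1 h1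
    exact hne ⟨P, hP, hf⟩

/-- **Inertness from the count**: in a cubic field, if `p ∤ d_K` and no prime above `p` has residue
degree one, then `p𝓞_K` is a prime ideal, i.e. `p` is INERT in `K` (the residue degrees above `p`
are `≥ 2` and sum to `3`, so there is exactly one prime above `p`, with `e = 1`, `f = 3`). -/
theorem isPrime_span_of_count_one_eq_zero (h3 : Module.finrank ℚ K = 3) {p : ℕ} (hp : p.Prime)
    (hd : ¬ (p : ℤ) ∣ NumberField.discr K) (h0 : (splittingType K p).count 1 = 0) :
    (span {(p : 𝓞 K)}).IsPrime := by
  classical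
  set nf := normalizedFactors (span {(p : 𝓞 K)}) with hnf
  have hnd : nf.Nodup := nodup_normalizedFactors_of_not_dvd_discr hp hd
  have hT : splittingType K p = nf.map (fun P => P.inertiaDeg ℤ) := by
    rw [splittingType, ← hnf, Multiset.dedup_eq_self.mpr hnd]
  have hsum := sum_splittingType_eq_finrank hp hd (K := K)
  rw [h3] at hsum
  -- every residue degree is `≥ 2`, so there is exactly one prime above `p`
  have hge2 : ∀ f ∈ splittingType K p, 2 ≤ f := by
    intro f hf
    have h1 : f ≠ 1 := fun h => by
      rw [Multiset.count_eq_zero] at h0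
      exact h0 (h ▸ hf)
    have := splittingType_pos hp hf
    omega
  have hcard : Multiset.card (splittingType K p) = 1 := by
    have hle : 2 * Multiset.card (splittingType K p) ≤ (splittingType K p).sum := by
      have := Multiset.card_nsmul_le_sum hge2
      simpa [smul_eq_mul, mul_comm] using this
    rcases Nat.lt_or_ge (Multiset.card (splittingType K p)) 2 with h | h
    · interval_cases hc : Multiset.card (splittingType K p)
      · rw [Multiset.card_eq_zero] at hc
        rw [hc, Multiset.sum_zero] at hsum
        exact absurd hsum (by norm_num)
      · rfl
    · omega
  rw [hT, Multiset.card_map] at hcard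
  obtain ⟨P, hP⟩ := Multiset.card_eq_one.mp hcard
  have hI : span {(p : 𝓞 K)} ≠ ⊥ := by
    rw [Ne, span_singleton_eq_bot]
    exact_mod_cast hp.ne_zero
  have hassoc := prod_normalizedFactors hI
  rw [← hnf, hP, Multiset.prod_singleton] at hassoc
  rw [← associated_iff_eq.mp hassoc]
  have hPmem : P ∈ normalizedFactors (span {(p : 𝓞 K)}) := by
    rw [← hnf, hP]; exact Multiset.mem_singleton_self P
  exact Ideal.isPrime_of_prime (prime_of_normalized_factor P hPmem)

/-- Splitting a splitting type into its `1`'s and the rest: `Σ T = a(p) + Σ (T ∖ 1's)`, and every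
element of the rest is `≥ 2`. -/
private theorem sum_eq_count_one_add {p : ℕ} (hp : p.Prime) :
    (splittingType K p).sum = (splittingType K p).count 1 +
      ((splittingType K p).filter (· ≠ 1)).sum ∧
    ∀ f ∈ (splittingType K p).filter (· ≠ 1), 2 ≤ f := by
  classical
  constructor
  · conv_lhs => rw [← Multiset.filter_add_not (· = 1) (splittingType K p)]
    rw [Multiset.sum_add, Multiset.filter_eq', Multiset.sum_replicate, smul_eq_mul, mul_one]
  · intro f hf
    rw [Multiset.mem_filter] at hf
    have := splittingType_pos hp hf.1
    omega

/-- **Type `(1,2)` from the count**: in a cubic field, at `p ∤ d_K`, `a_K(p) = 1` forces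
`T_K(p) = {1, 2}` (`p = 𝔭₁𝔭₂` with residue degrees `1` and `2`). -/
theorem splittingType_eq_of_count_one_eq_one (h3 : Module.finrank ℚ K = 3) {p : ℕ} (hp : p.Prime)
    (hd : ¬ (p : ℤ) ∣ NumberField.discr K) (h1 : (splittingType K p).count 1 = 1) :
    splittingType K p = {1, 2} := by
  classical
  obtain ⟨hsum, hge⟩ := sum_eq_count_one_add (K := K) hp
  rw [sum_splittingType_eq_finrank hp hd, h3, h1] at hsum
  set R := (splittingType K p).filter (· ≠ 1) with hR
  have hRsum : R.sum = 2 := by omega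
  -- `R` has sum `2` and elements `≥ 2`: `R = {2}`
  have hRcard : Multiset.card R = 1 := by
    have hle : 2 * Multiset.card R ≤ R.sum := by
      have := Multiset.card_nsmul_le_sum hge
      simpa [smul_eq_mul, mul_comm] using this
    rcases Nat.lt_or_ge (Multiset.card R) 2 with h | h
    · interval_cases hc : Multiset.card R
      · rw [Multiset.card_eq_zero] at hc
        rw [hc, Multiset.sum_zero] at hRsum
        exact absurd hRsum (by norm_num)
      · rfl
    · omega
  obtain ⟨f, hf⟩ := Multiset.card_eq_one.mp hRcard
  have hf2 : f = 2 := by rw [hf, Multiset.sum_singleton] at hRsum; exact hRsum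
  have hdecomp := Multiset.filter_add_not (· = 1) (splittingType K p)
  rw [Multiset.filter_eq', h1, ← hR, hf, hf2] at hdecomp
  rw [← hdecomp]
  rfl

/-- **Complete splitting from the count**: in a cubic field, at `p ∤ d_K`, `a_K(p) = 3` forces
`T_K(p) = {1, 1, 1}`. -/
theorem splittingType_eq_of_count_one_eq_three (h3 : Module.finrank ℚ K = 3) {p : ℕ}
    (hp : p.Prime) (hd : ¬ (p : ℤ) ∣ NumberField.discr K) (h1 : (splittingType K p).count 1 = 3) :
    splittingType K p = {1, 1, 1} := by
  classical
  obtain ⟨hsum, hge⟩ := sum_eq_count_one_add (K := K) hp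
  rw [sum_splittingType_eq_finrank hp hd, h3, h1] at hsum
  set R := (splittingType K p).filter (· ≠ 1) with hR
  have hRsum : R.sum = 0 := by omega
  have hR0 : R = 0 := by
    rw [Multiset.eq_zero_iff_forall_notMem]
    intro f hf
    have h2 := hge f hf
    have := Multiset.le_sum_of_mem hf
    omega
  have hdecomp := Multiset.filter_add_not (· = 1) (splittingType K p)
  rw [Multiset.filter_eq', h1, ← hR, hR0, add_zero] at hdecomp
  rw [← hdecomp]
  rfl

end General

/-! ### The `S₃`-dictionary at a prime `p ∤ d_N` -/

section Sextic

variable {N : Type*} [Field N] [NumberField N] [IsGalois ℚ N]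

/-- **Counting `1`'s in the multiset identity**: `a_N(p) + 2 = a_k(p) + 2 a_K(p)` at every prime. -/
theorem sextic_count_one_add_two (h6 : Module.finrank ℚ N = 6)
    (hna : ∃ g h : N ≃ₐ[ℚ] N, g * h ≠ h * g) (K k : IntermediateField ℚ N)
    (hK : Module.finrank ℚ K = 3) (hk : Module.finrank ℚ k = 2) {p : ℕ} (hp : p.Prime) :
    (splittingType N p).count 1 + 2 = (splittingType k p).count 1 + 2 * (splittingType K p).count 1 := by
  have h := congrArg (Multiset.count 1) (splittingType_sextic_add_two_eq N h6 hna K k hK hk hp)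
  simp only [Multiset.count_add, Multiset.count_replicate_self] at h
  omega

/-- **The dictionary.** At `p ∤ d_N`: `(a_k(p), a_K(p), a_N(p)) ∈ {(2,3,6), (0,1,0), (2,0,0)}`. -/
theorem sextic_dictionary (h6 : Module.finrank ℚ N = 6)
    (hna : ∃ g h : N ≃ₐ[ℚ] N, g * h ≠ h * g) (K k : IntermediateField ℚ N)
    (hK : Module.finrank ℚ K = 3) (hk : Module.finrank ℚ k = 2) {p : ℕ} (hp : p.Prime)
    (hd : ¬ (p : ℤ) ∣ NumberField.discr N) :
    ((splittingType k p).count 1 = 2 ∧ (splittingType K p).count 1 = 3 ∧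
        (splittingType N p).count 1 = 6) ∨
      ((splittingType k p).count 1 = 0 ∧ (splittingType K p).count 1 = 1 ∧
        (splittingType N p).count 1 = 0) ∨
      ((splittingType k p).count 1 = 2 ∧ (splittingType K p).count 1 = 0 ∧
        (splittingType N p).count 1 = 0) := by
  have hid := sextic_count_one_add_two h6 hna K k hK hk hp
  have hN := count_one_splittingType_eq_zero_or_eq_finrank (N := N) hp hd
  rw [h6] at hN
  have hk2 := count_one_splittingType_le_finrank (K := k) hp
  have hK3 := count_one_splittingType_le_finrank (K := K) hp
  rw [hk] at hk2
  rw [hK] at hK3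
  omega

/-- **Inert primes, `(ℚ, k, K)`-form**: at `p ∤ d_N`, `3·𝟙[p inert in K] + a_K(p) = 1 + a_k(p)`. -/
theorem sextic_three_mul_inert_add (h6 : Module.finrank ℚ N = 6)
    (hna : ∃ g h : N ≃ₐ[ℚ] N, g * h ≠ h * g) (K k : IntermediateField ℚ N)
    (hK : Module.finrank ℚ K = 3) (hk : Module.finrank ℚ k = 2) {p : ℕ} (hp : p.Prime)
    (hd : ¬ (p : ℤ) ∣ NumberField.discr N) :
    3 * (if (splittingType K p).count 1 = 0 then 1 else 0) + (splittingType K p).count 1 =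
      1 + (splittingType k p).count 1 := by
  rcases sextic_dictionary h6 hna K k hK hk hp hd with ⟨h1, h2, -⟩ | ⟨h1, h2, -⟩ | ⟨h1, h2, -⟩ <;>
    simp [h1, h2]

/-- **Inert primes, `(k, N)`-form**: at `p ∤ d_N`, `6·𝟙[p inert in K] + a_N(p) = 3 a_k(p)`. -/
theorem sextic_six_mul_inert_add (h6 : Module.finrank ℚ N = 6)
    (hna : ∃ g h : N ≃ₐ[ℚ] N, g * h ≠ h * g) (K k : IntermediateField ℚ N)
    (hK : Module.finrank ℚ K = 3) (hk : Module.finrank ℚ k = 2) {p : ℕ} (hp : p.Prime)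
    (hd : ¬ (p : ℤ) ∣ NumberField.discr N) :
    6 * (if (splittingType K p).count 1 = 0 then 1 else 0) + (splittingType N p).count 1 =
      3 * (splittingType k p).count 1 := by
  rcases sextic_dictionary h6 hna K k hK hk hp hd with ⟨h1, h2, h3⟩ | ⟨h1, h2, h3⟩ | ⟨h1, h2, h3⟩ <;>
    simp [h1, h2, h3]

/-- **Partially split primes**: at `p ∤ d_N`, `2·𝟙[a_K(p) = 1] + a_k(p) = 2` (the primes of
splitting type `(1,2)` in `K` are exactly the primes inert in `k`). -/
theorem sextic_two_mul_partial_add (h6 : Module.finrank ℚ N = 6)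
    (hna : ∃ g h : N ≃ₐ[ℚ] N, g * h ≠ h * g) (K k : IntermediateField ℚ N)
    (hK : Module.finrank ℚ K = 3) (hk : Module.finrank ℚ k = 2) {p : ℕ} (hp : p.Prime)
    (hd : ¬ (p : ℤ) ∣ NumberField.discr N) :
    2 * (if (splittingType K p).count 1 = 1 then 1 else 0) + (splittingType k p).count 1 = 2 := by
  rcases sextic_dictionary h6 hna K k hK hk hp hd with ⟨h1, h2, -⟩ | ⟨h1, h2, -⟩ | ⟨h1, h2, -⟩ <;>
    simp [h1, h2]

/-- **Completely split primes**: at `p ∤ d_N`, `a_N(p) = 6·𝟙[a_K(p) = 3]`. -/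
theorem sextic_count_one_eq_six_mul_split (h6 : Module.finrank ℚ N = 6)
    (hna : ∃ g h : N ≃ₐ[ℚ] N, g * h ≠ h * g) (K k : IntermediateField ℚ N)
    (hK : Module.finrank ℚ K = 3) (hk : Module.finrank ℚ k = 2) {p : ℕ} (hp : p.Prime)
    (hd : ¬ (p : ℤ) ∣ NumberField.discr N) :
    (splittingType N p).count 1 = 6 * (if (splittingType K p).count 1 = 3 then 1 else 0) := by
  rcases sextic_dictionary h6 hna K k hK hk hp hd with ⟨h1, h2, h3⟩ | ⟨h1, h2, h3⟩ | ⟨h1, h2, h3⟩ <;>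
    simp [h2, h3]

end Sextic

end Summit.QuantumAdvantage.QuantumAdvantage.Theorems.DegreeOnePrimesEscape

end
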